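import Summits.AtomisticToContinuum.BoseEinsteinCondensation.Theorems.BECConjugateDominationHardCoreExtensionAlphaPair
import Summits.AtomisticToContinuum.BoseEinsteinCondensation.Theorems.BECConjugateDominationHardCoreExtensionPairKineticTightness
import Summits.AtomisticToContinuum.BoseEinsteinCondensation.Theorems.BECConjugateDominationHardCoreExtensionPairShellMass
import Summits.AtomisticToContinuum.BoseEinsteinCondensation.Theorems.BECConjugateDominationHardCoreExtensionTruncationGapOfLimitGap
import Summits.AtomisticToContinuum.BoseEinsteinCondensation.Theorems.BECConjugateDominationHardCoreExtensionKyFanTwoFinite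
import HarnessLib

/-!
# Truncation convergence of the Ky Fan two-level at hard cores — UNCONDITIONAL, and the uniform truncation gap
# (β') of the physical class from a gap of `v` (line `third-law-current-floor`, crux `HardCoreExtension`,
# stmt-AtomisticToContinuum-11786, lead c1, cycle 2)

The composition node `stub_truncationKyFanConvergencePhys_of` (…AlphaPair.lean) fed with the landed analytic inputs —
kinetic tightness of near-optimal pairs (`stub_pairKineticTightness_of` ∘ `stub_traceCauchy_of` ∘ `stub_gramSchmidtPair`)
and the pair-shell mass bound `stub_pairShellMassBoundV2` — gives, for every admissible `v` with `v = ⊤` on `[0,a)` and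
`v ≤ M < ⊤` on `(a,∞)`, every `N`, every `L > 4a` with `kyFanTwo v N L < ⊤` and every `ε > 0`:
`kyFanTwo v N L ≤ kyFanTwo (min(v,n)) N L + ε` for all large `n` (`stub_truncationKyFanConvergencePhys`, registered).
Consequently (`uniformTruncationKyFanGap_of_gap_phys`) a Ky Fan gap `2E₀(v) + γ ≤ K₂(v)` of `v` itself at `(N, L)`,
`N ≥ 1`, `E₀(v) < ⊤`, propagates to ALL high truncations with gap `γ/2` (`stub_kyFanTwo_ne_top`,
`stub_truncationGapOfLimitGap`): the hypothesis (β') of `stub_truncationTransferOfUniformGap` on the physical hard-core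
class is reduced to the Ky Fan gap of `v` (S5'' `stub_diluteHardCoreKyFanGap`). No form-core, trace or capacity theorem
is used. [folklore; the Lean route is new]
-/

noncomputable section

namespace Summit.AtomisticToContinuum.BoseEinsteinCondensation.Cruxes.HardCoreExtension.ThirdLawCurrentFloor

open MeasureTheory Filter
open scoped ENNReal NNReal BigOperators Topology
open Literature.MathematicalPhysics.QuantumManyBody.BoseGas

/-- **Truncation convergence from below of the Ky Fan two-level at hard-core-type potentials (unconditional;
registered `stub_truncationKyFanConvergencePhys`).** [folklore] -/
theorem stub_truncationKyFanConvergencePhys :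
    ∀ (v : ℝ → ℝ≥0∞) (a : ℝ) (M : ℝ≥0∞), IsRepulsiveFiniteRange v → 0 < a →
      (∀ r, 0 ≤ r → r < a → v r = ⊤) → M ≠ ⊤ → (∀ r, a < r → v r ≤ M) →
      ∀ (N : ℕ) (L : ℝ), 4 * a < L → kyFanTwo v N L ≠ ⊤ →
      ∀ ε : ℝ, 0 < ε → ∃ n₀ : ℕ, ∀ n : ℕ, n₀ ≤ n →
        kyFanTwo v N L ≤ kyFanTwo (fun r => min (v r) (n : ℝ≥0∞)) N L + ENNReal.ofReal ε :=
  stub_truncationKyFanConvergencePhys_of (stub_pairKineticTightness_of (stub_traceCauchy_of stub_gramSchmidtPair))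
    stub_pairShellMassBoundV2

/-- **The hard-core potential itself**: `K₂(hardCorePotential a, N, L) ≤ K₂(min(hardCorePotential a, n), N, L) + ε` for
all large `n`, whenever `L > 4a > 0` and the Ky Fan level is finite. [folklore] -/
theorem truncationKyFanConvergence_hardCorePotential {a : ℝ} (ha : 0 < a) {N : ℕ} {L : ℝ} (h4a : 4 * a < L)
    (hK : kyFanTwo (hardCorePotential a) N L ≠ ⊤) {ε : ℝ} (hε : 0 < ε) :
    ∃ n₀ : ℕ, ∀ n : ℕ, n₀ ≤ n → kyFanTwo (hardCorePotential a) N L ≤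
      kyFanTwo (fun r => min (hardCorePotential a r) (n : ℝ≥0∞)) N L + ENNReal.ofReal ε :=
  stub_truncationKyFanConvergencePhys (hardCorePotential a) a 0 (isRepulsiveFiniteRange_hardCorePotential a) ha
    (fun _ _ hr => hardCorePotential_of_lt hr) ENNReal.zero_ne_top
    (fun _ hr => (hardCorePotential_of_le hr.le).le) N L h4a hK ε hε

/-- **(β') on the physical class from a gap of `v`**: for `v = ⊤` on `[0,a)`, `v ≤ M < ⊤` on `(a,∞)`, `L > 4a`, `N ≥ 1`,
`E₀(v,N,L) < ⊤`, a Ky Fan gap `2E₀(v) + γ ≤ K₂(v)` propagates to every high truncation with gap `γ/2`. [folklore] -/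
theorem uniformTruncationKyFanGap_of_gap_phys :
    ∀ (v : ℝ → ℝ≥0∞) (a : ℝ) (M : ℝ≥0∞), IsRepulsiveFiniteRange v → 0 < a →
      (∀ r, 0 ≤ r → r < a → v r = ⊤) → M ≠ ⊤ → (∀ r, a < r → v r ≤ M) →
      ∀ (N : ℕ) (L : ℝ), 4 * a < L → 1 ≤ N → periodicGroundStateEnergy v N L ≠ ⊤ →
      ∀ γ : ℝ, 0 < γ → 2 * periodicGroundStateEnergy v N L + ENNReal.ofReal γ ≤ kyFanTwo v N L →
      ∃ n₀ : ℕ, ∀ n : ℕ, n₀ ≤ n →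
        2 * periodicGroundStateEnergy (fun r => min (v r) (n : ℝ≥0∞)) N L + ENNReal.ofReal (γ / 2) ≤
          kyFanTwo (fun r => min (v r) (n : ℝ≥0∞)) N L := by
  intro v a M hv ha hcore hM htail N L h4a hN hE γ hγ hgap
  have hL : 0 < L := by linarith
  have hK : kyFanTwo v N L ≠ ⊤ := stub_kyFanTwo_ne_top v hv.1 N L hL hN hE
  exact stub_truncationGapOfLimitGap v N L γ hγ hgap
    (stub_truncationKyFanConvergencePhys v a M hv ha hcore hM htail N L h4a hK (γ / 2) (by positivity))

end Summit.AtomisticToContinuum.BoseEinsteinCondensation.Cruxes.HardCoreExtension.ThirdLawCurrentFloor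

end
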